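/-
Copyright: the b2b-balaban T⁴-continuum CRUX team, row NE7b OWNER lineage `t4-ne7b-p1` (gen 121). Project licence.
-/
import Summits.QuantumFields.BalabanUV.T4Continuum.Spine.NE7b.SupTorusComparisonDecay
import Summits.QuantumFields.BalabanUV.T4Continuum.Spine.NE7b.SupTorusSupNormBound

/-!
# THE POINTWISE THEORY IS CLOSED UNDER COMPOSITION: a source with an exponential SUP profile `|f| ≤ M·e^{−γρ_s(bt ·, y₀)}` (no support
# condition) gives `|H_V⁻¹f| ≤ C·M·e^{−δρ_s(bt ·, y₀)}` at EVERY site on the strictly convex class `V ≥ v₀ > 0`, `(C, δ)` from `(d, a, v₀, γ)`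
# only, every mesh, every volume — the `ℓ^∞` analogue of (141)'s block-profile lemma; on the way, on the road's class `V ≥ −λ`: the block
# means of `H⁻¹f` inherit the profile (duality with the block columns, whose block `ℓ¹` norms decay, and a coarse convolution)
# (row NE7b, node U5c; (131)–(134), (138), (144), (146), (148) BY NAME; [folklore])

Cell `pub-balaban`, sub-cell `t4`, spine estimate NE7b (`T4WeightBudget.RelWeightBound`; the cell's OWN estimate — NOT PRINTED in
[Bałaban 1983–89], NOT PROVED).  Crux-route work under `Spine/NE7b/` by the row OWNER (`t4-ne7b-p1` gen 121, file (149)) under FREEZE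
(0)'s crux-prover clause; NOTHING of Bałaban's is named as a Lean object, valued or asserted; no `T4Continuum/Support` leaf typed; no `def`,
no notation (the action DISPLAYED); zero `sorry`.  Imports (BY NAME): the OWNER's (146) `…SupTorusComparisonDecay` (`pointwise_decay`), (148)
`…SupTorusSupNormBound` (`exists_blockColumns`, `blockSum_eq_pairing`; through it (144) `blockTerm_eq`, (138) `coarse_convolution_le`, (134)
`schur_column_sq_le`, (132) `isPseudoDist_torus`, (131) `exists_rate`, (89) TDF `sum_fine_eq_sum_blocks`, `siteOf_chart_surjective`).

WHY (located).  (147) decays `H⁻¹f` pointwise for `f` in ONE block; iterating the column's objects (`H⁻¹(V₁ − V₂)H⁻¹`, `H⁻¹Q′t*T⁻¹Q′tH⁻¹`, …)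
feeds `H⁻¹` sources that are spread but DECAYING in sup norm — the pointwise currency needs the same closure (141) gave the block-`ℓ²`
currency.  The block means of `u = H⁻¹f` are `(n+1)^{−d}⟨ψ_y, f⟩` ((148) duality); blockwise `|⟨ψ_y, f⟩| ≤ Σ_{y′}‖ψ_y‖_{ℓ¹(B_{y′})}·Me^{−γρ_s(y′,y₀)}`
with `‖ψ_y‖_{ℓ¹(B_{y′})} ≤ (n+1)^d m_κ⁻¹e^{2dκ}e^{−κρ_s(y′,y)}` ((134) + Cauchy–Schwarz), and (138) `coarse_convolution_le` gives the profile
`m_κ⁻¹e^{2dκ}MK_δe^{−δρ_s(y,y₀)}` (`δ ≤ κ`, `2δ ≤ γ`) — on the road's class `V ≥ −λ`.  On `V ≥ v₀ > 0`, `L_Vu = f − a·(block means)` then has a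
decaying sup profile and (146) `pointwise_decay` converts it into the solution's.

WHAT IS PROVED ([folklore]; fine torus `Site d ((n+1)s)`, coarse `Site d s`, `[NeZero s]`; the action DISPLAYED; `bt x = σ_s(blk n (wm x))`;
`m_κ = min(2,a) − λ − 2dκ² − a(e^{2dκ} − 1)`; `K_δ = (2∕(1 − e^{−δ}))^d`; columns `Hψ_{y′} = 𝟙[bt · = y′]`):
* §1 (`V ≥ −λ`, `0 < κ ≤ 1`, `m_κ > 0`) **`column_blockL1_le`** (`Σ_z |ψ_y(σ(chart (wm y′) z))| ≤ (n+1)^d m_κ⁻¹e^{2dκ}e^{−κρ_s(y′,y)}`),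
  **`blockMean_le_of_supProfile`** (`|f| ≤ Me^{−γρ_s(bt ·, y₀)}`, `δ ≤ κ`, `2δ ≤ γ`, `Hu = f` ⟹ `|(n+1)^{−d}Σ_z u(σ(chart (wm y) z))| ≤
  m_κ⁻¹e^{2dκ}MK_δe^{−δρ_s(y,y₀)}`).
* §2 THE HEADLINE **`pointwise_decay_of_supProfile`**: `∃ C δ > 0` from `(d, a, v₀, γ)` only (`a > 0`, `v₀ > 0`, `γ > 0`) such that for ALL
  `n, s`, ALL `V ≥ v₀`, every `y₀`, EVERY `f` with `|f x| ≤ Me^{−γρ_s(bt x, y₀)}` and every `Hu = f`: `|u x| ≤ C·M·e^{−δρ_s(bt x, y₀)}` at every site.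
* §3 toy.

HONEST (what this is NOT).  The STRICTLY CONVEX single-site class only for the pointwise end (§1 holds on `V ≥ −λ`); the rate halves at
each composition (explicit, far from sharp); `ℓ¹` circular geometry, cubic periods; scalar skeleton ((A3), NC-NE7b-α UNRULED); nothing of
the covariant propagators of [B4]–[B6]; nothing of Bałaban's.  BY-NAME EFFECT ON THE WALL: NONE.  NE7b NOT PRINTED ∕ NOT PROVED; spine
PROVED 0∕9; rung (B)+1 on a FINITE torus — NOT infinite volume, NOT the mass gap, NOT Clay.  HONEST DEPENDENCY: continuum YM on T⁴ ⇐
BetaPertH ∧ nine spine estimates (0∕9 proved); BetaPertH ⇐ (D1) ∧ (D4) ∧ CAP+tail; G-an2-4 gates asym, D1 and NE2∕3∕4.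
-/

set_option autoImplicit false

noncomputable section

namespace Summit.QuantumFields.BalabanUV.T4Continuum.NE7b.SupTorusPointwiseProfile

open Real
open Literature.MathematicalPhysics.QuantumFieldTheory.Balaban1983to89
open B6QGQLower276 (X e blk B side chart mem_B sum_B sum_B_const card_cube blk_chart)
open Beta (Site siteOf windowMap siteOf_windowMap siteOf_add)
open SupTorusDirichletForm (siteOf_chart_surjective blockOf_siteOf_of_mem sum_fine_eq_sum_blocks)
open SupTorusHessianCombesThomas (exists_rate)
open SupTorusBlockDistance (isPseudoDist_torus)
open SupTorusSchurComplement (schur_column_sq_le)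
open SupTorusPropagatorLocality (coarse_convolution_le)
open SupTorusMaximumPrinciple (blockTerm_eq)
open SupTorusComparisonDecay (pointwise_decay)
open SupTorusSupNormBound (exists_blockColumns blockSum_eq_pairing)

variable {d : ℕ}

/-! ## §1. A source with an exponential SUP profile: the block means of `H⁻¹f` inherit the profile (road's class `V ≥ −λ`) -/

section Means

variable (n : ℕ) (a : ℝ) (s : ℕ) [NeZero s] (ha : 0 ≤ a) {lam κ γ δ M : ℝ} (hκ0 : 0 < κ) (hκ1 : κ ≤ 1)
  (hm : 0 < min 2 a - lam - 2 * d * κ ^ 2 - a * (exp (2 * d * κ) - 1)) (hδ : 0 < δ) (hδκ : δ ≤ κ) (h2δ : 2 * δ ≤ γ)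
  (V : Site d ((n + 1) * s) → ℝ) (hV : ∀ x, -lam ≤ V x)
  (ψ : Site d s → Site d ((n + 1) * s) → ℝ)
  (hψ : ∀ y' x, ((n : ℝ) + 1) ^ 2 * ∑ μ, (2 * ψ y' x - ψ y' (x + siteOf d ((n + 1) * s) (e μ)) - ψ y' (x - siteOf d ((n + 1) * s) (e μ)))
      + a / ((n : ℝ) + 1) ^ d * ∑ q ∈ B n (blk n (windowMap d ((n + 1) * s) x)), ψ y' (siteOf d ((n + 1) * s) q) + V x * ψ y' x
      = if siteOf d s (blk n (windowMap d ((n + 1) * s) x)) = y' then 1 else 0)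
  (y₀ : Site d s) (u f : Site d ((n + 1) * s) → ℝ)
  (hf : ∀ x, |f x| ≤ M * exp (-(γ * ∑ i, ((((siteOf d s (blk n (windowMap d ((n + 1) * s) x))) i - y₀ i).valMinAbs.natAbs : ℕ) : ℝ))))
  (hu : ∀ x, ((n : ℝ) + 1) ^ 2 * ∑ μ, (2 * u x - u (x + siteOf d ((n + 1) * s) (e μ)) - u (x - siteOf d ((n + 1) * s) (e μ)))
      + a / ((n : ℝ) + 1) ^ d * ∑ q ∈ B n (blk n (windowMap d ((n + 1) * s) x)), u (siteOf d ((n + 1) * s) q) + V x * u x = f x)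

include ha hκ0 hκ1 hm hV hψ in
/-- **THE BLOCK `ℓ¹` NORMS OF A BLOCK COLUMN DECAY**: `Σ_z |ψ_y(σ(chart (wm y′) z))| ≤ (n+1)^d·m_κ⁻¹e^{2dκ}·e^{−κρ_s(y′,y)}` — Cauchy–Schwarz on
(134) `schur_column_sq_le`. [folklore] -/
theorem column_blockL1_le (y y' : Site d s) :
    ∑ z : Fin d → Fin (n + 1), |ψ y (siteOf d ((n + 1) * s) (chart n (windowMap d s y') z))|
      ≤ ((n : ℝ) + 1) ^ d * ((min 2 a - lam - 2 * d * κ ^ 2 - a * (exp (2 * d * κ) - 1))⁻¹ * exp (2 * d * κ))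
        * exp (-(κ * ∑ i, (((y' i - y i).valMinAbs.natAbs : ℕ) : ℝ))) := by
  classical
  set m := min 2 a - lam - 2 * d * κ ^ 2 - a * (exp (2 * d * κ) - 1) with hm_def
  have hvol : (0 : ℝ) < ((n : ℝ) + 1) ^ d := by positivity
  have hCS := sq_sum_le_card_mul_sum_sq (s := (Finset.univ : Finset (Fin d → Fin (n + 1))))
    (f := fun z => |ψ y (siteOf d ((n + 1) * s) (chart n (windowMap d s y') z))|)
  rw [Finset.card_univ, card_cube] at hCS
  simp only [sq_abs] at hCS
  have hcol := schur_column_sq_le n a s ha hκ0.le hκ1 hm V hV ψ hψ y' y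
  have h4 : exp (4 * d * κ) = exp (2 * d * κ) ^ 2 := by rw [sq, ← exp_add]; ring_nf
  have h5 : exp (-(2 * κ * ∑ i, (((y' i - y i).valMinAbs.natAbs : ℕ) : ℝ)))
      = exp (-(κ * ∑ i, (((y' i - y i).valMinAbs.natAbs : ℕ) : ℝ))) ^ 2 := by rw [sq, ← exp_add]; ring_nf
  have hR : 0 ≤ ((n : ℝ) + 1) ^ d * (m⁻¹ * exp (2 * d * κ)) * exp (-(κ * ∑ i, (((y' i - y i).valMinAbs.natAbs : ℕ) : ℝ))) := by
    have : 0 ≤ m⁻¹ := inv_nonneg.2 hm.le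
    positivity
  have hsq : (∑ z : Fin d → Fin (n + 1), |ψ y (siteOf d ((n + 1) * s) (chart n (windowMap d s y') z))|) ^ 2
      ≤ (((n : ℝ) + 1) ^ d * (m⁻¹ * exp (2 * d * κ)) * exp (-(κ * ∑ i, (((y' i - y i).valMinAbs.natAbs : ℕ) : ℝ)))) ^ 2 := by
    refine hCS.trans ((mul_le_mul_of_nonneg_left hcol hvol.le).trans (le_of_eq ?_))
    rw [h4, h5]; ring
  exact (abs_le_of_sq_le_sq' hsq hR).2

include ha hκ0 hκ1 hm hδ hδκ h2δ hV hψ hf hu in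
/-- **THE BLOCK MEANS OF `H⁻¹f` INHERIT THE SOURCE'S SUP PROFILE** (road's class `V ≥ −λ`): if `|f x| ≤ M·e^{−γρ_s(bt x, y₀)}`, `δ ≤ κ`, `2δ ≤ γ`,
then `|(n+1)^{−d}Σ_z u(σ(chart (wm y) z))| ≤ m_κ⁻¹e^{2dκ}·M·K_δ·e^{−δρ_s(y,y₀)}` — duality ((148) `blockSum_eq_pairing`) read blockwise, the
column's block `ℓ¹` letters, and (138) `coarse_convolution_le`. [folklore] -/
theorem blockMean_le_of_supProfile (y : Site d s) :
    |(((n : ℝ) + 1) ^ d)⁻¹ * ∑ z : Fin d → Fin (n + 1), u (siteOf d ((n + 1) * s) (chart n (windowMap d s y) z))|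
      ≤ ((min 2 a - lam - 2 * d * κ ^ 2 - a * (exp (2 * d * κ) - 1))⁻¹ * exp (2 * d * κ)) * M * (2 * (1 - exp (-δ))⁻¹) ^ d
        * exp (-(δ * ∑ i, (((y i - y₀ i).valMinAbs.natAbs : ℕ) : ℝ))) := by
  classical
  set m := min 2 a - lam - 2 * d * κ ^ 2 - a * (exp (2 * d * κ) - 1) with hm_def
  have hvol : (0 : ℝ) < ((n : ℝ) + 1) ^ d := by positivity
  have hminv : 0 ≤ m⁻¹ := inv_nonneg.2 hm.le
  have hM : 0 ≤ M := by
    have h1 := (abs_nonneg _).trans (hf (siteOf d ((n + 1) * s) (chart n (windowMap d s y₀) 0)))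
    exact le_of_mul_le_mul_right (by rw [zero_mul]; exact h1) (exp_pos _)
  rw [blockSum_eq_pairing n a s V ψ hψ u f hu y, abs_mul, abs_of_pos (inv_pos.2 hvol)]
  -- `Σ_x ψ_y x f x` blockwise: block `y′` contributes `≤ (Σ_{B_{y′}}|ψ_y|)·M e^{−γρ_s(y′,y₀)}`
  rw [sum_fine_eq_sum_blocks n s (fun x => ψ y x * f x)]
  have hblk : ∀ (y' : Site d s) (p : X d), p ∈ B n (windowMap d s y') →
      siteOf d s (blk n (windowMap d ((n + 1) * s) (siteOf d ((n + 1) * s) p))) = y' := fun y' p hp => blockOf_siteOf_of_mem n s hp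
  have hterm : ∀ y' : Site d s, |∑ p ∈ B n (windowMap d s y'), ψ y (siteOf d ((n + 1) * s) p) * f (siteOf d ((n + 1) * s) p)|
      ≤ (((n : ℝ) + 1) ^ d * (m⁻¹ * exp (2 * d * κ)) * exp (-(κ * ∑ i, (((y' i - y i).valMinAbs.natAbs : ℕ) : ℝ))))
        * (M * exp (-(γ * ∑ i, (((y' i - y₀ i).valMinAbs.natAbs : ℕ) : ℝ)))) := by
    intro y'
    calc |∑ p ∈ B n (windowMap d s y'), ψ y (siteOf d ((n + 1) * s) p) * f (siteOf d ((n + 1) * s) p)|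
        ≤ ∑ p ∈ B n (windowMap d s y'), |ψ y (siteOf d ((n + 1) * s) p) * f (siteOf d ((n + 1) * s) p)| := Finset.abs_sum_le_sum_abs _ _
      _ ≤ ∑ p ∈ B n (windowMap d s y'), |ψ y (siteOf d ((n + 1) * s) p)|
          * (M * exp (-(γ * ∑ i, (((y' i - y₀ i).valMinAbs.natAbs : ℕ) : ℝ)))) := by
          refine Finset.sum_le_sum fun p hp => ?_
          rw [abs_mul]
          refine mul_le_mul_of_nonneg_left ?_ (abs_nonneg _)
          have h := hf (siteOf d ((n + 1) * s) p)
          rwa [hblk y' p hp] at h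
      _ = (∑ p ∈ B n (windowMap d s y'), |ψ y (siteOf d ((n + 1) * s) p)|)
          * (M * exp (-(γ * ∑ i, (((y' i - y₀ i).valMinAbs.natAbs : ℕ) : ℝ)))) := (Finset.sum_mul _ _ _).symm
      _ ≤ _ := by
          refine mul_le_mul_of_nonneg_right ?_ (by positivity)
          rw [sum_B]
          exact column_blockL1_le n a s ha hκ0 hκ1 hm V hV ψ hψ y y'
  -- the coarse convolution with the profiles `e^{−κρ(y,y′)}` and `e^{−γρ(y′,y₀)}`
  have hconv := coarse_convolution_le s hδ hδκ h2δ (by positivity : 0 ≤ ((n : ℝ) + 1) ^ d * (m⁻¹ * exp (2 * d * κ))) hM y y₀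
    (fun y' => ((n : ℝ) + 1) ^ d * (m⁻¹ * exp (2 * d * κ)) * exp (-(κ * ∑ i, (((y i - y' i).valMinAbs.natAbs : ℕ) : ℝ))))
    (fun y' => M * exp (-(γ * ∑ i, (((y' i - y₀ i).valMinAbs.natAbs : ℕ) : ℝ))))
    (fun y' => by rw [abs_of_nonneg (by positivity)]) (fun y' => by rw [abs_of_nonneg (by positivity)])
  have hsum : |∑ y' : Site d s, ∑ p ∈ B n (windowMap d s y'), ψ y (siteOf d ((n + 1) * s) p) * f (siteOf d ((n + 1) * s) p)|
      ≤ ∑ y' : Site d s, (((n : ℝ) + 1) ^ d * (m⁻¹ * exp (2 * d * κ)) * exp (-(κ * ∑ i, (((y i - y' i).valMinAbs.natAbs : ℕ) : ℝ))))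
        * (M * exp (-(γ * ∑ i, (((y' i - y₀ i).valMinAbs.natAbs : ℕ) : ℝ)))) := by
    refine (Finset.abs_sum_le_sum_abs _ _).trans (Finset.sum_le_sum fun y' _ => ?_)
    rw [(isPseudoDist_torus (d := d) s).symm y y']
    exact hterm y'
  have habs : |∑ y' : Site d s, (((n : ℝ) + 1) ^ d * (m⁻¹ * exp (2 * d * κ)) * exp (-(κ * ∑ i, (((y i - y' i).valMinAbs.natAbs : ℕ) : ℝ))))
        * (M * exp (-(γ * ∑ i, (((y' i - y₀ i).valMinAbs.natAbs : ℕ) : ℝ))))|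
      = ∑ y' : Site d s, (((n : ℝ) + 1) ^ d * (m⁻¹ * exp (2 * d * κ)) * exp (-(κ * ∑ i, (((y i - y' i).valMinAbs.natAbs : ℕ) : ℝ))))
        * (M * exp (-(γ * ∑ i, (((y' i - y₀ i).valMinAbs.natAbs : ℕ) : ℝ)))) :=
    abs_of_nonneg (Finset.sum_nonneg fun _ _ => by positivity)
  rw [← habs] at hsum
  rw [inv_mul_le_iff₀ hvol]
  refine (hsum.trans hconv).trans (le_of_eq ?_)
  ring

end Means

/-! ## §2. THE END: on the strictly convex class a source with an exponential sup profile gives a solution with one -/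

/-- **HEADLINE — `|f| ≤ M·e^{−γρ_s(bt ·, y₀)}` ⟹ `|H_V⁻¹f| ≤ C·M·e^{−δρ_s(bt ·, y₀)}` POINTWISE ON THE STRICTLY CONVEX CLASS `V ≥ v₀ > 0`,
every mesh, every volume** — `(C, δ)` from `(d, a, v₀, γ)` only, EVERY source with that profile (no support condition): the `ℓ^∞`
analogue of (141) `blockSq_le_of_blockProfile_source`, which makes the pointwise theory ((146)∕(147)∕(148)) CLOSED UNDER COMPOSITION.
`L_Vu = f − a·(block means of u)`, the block means carry the profile by §1 (with (148)'s columns), and (146) `pointwise_decay` finishes.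
[folklore] -/
theorem pointwise_decay_of_supProfile (a : ℝ) (ha : 0 < a) {v₀ γ : ℝ} (hv₀ : 0 < v₀) (hγ : 0 < γ) :
    ∃ C δ : ℝ, 0 < C ∧ 0 < δ ∧ ∀ (n s : ℕ) [NeZero s] (V : Site d ((n + 1) * s) → ℝ), (∀ x, v₀ ≤ V x) →
      ∀ (y₀ : Site d s) (M : ℝ) (u f : Site d ((n + 1) * s) → ℝ),
      (∀ x, |f x| ≤ M * exp (-(γ * ∑ i, ((((siteOf d s (blk n (windowMap d ((n + 1) * s) x))) i - y₀ i).valMinAbs.natAbs : ℕ) : ℝ)))) →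
      (∀ x, ((n : ℝ) + 1) ^ 2 * ∑ μ, (2 * u x - u (x + siteOf d ((n + 1) * s) (e μ)) - u (x - siteOf d ((n + 1) * s) (e μ)))
        + a / ((n : ℝ) + 1) ^ d * ∑ q ∈ B n (blk n (windowMap d ((n + 1) * s) x)), u (siteOf d ((n + 1) * s) q) + V x * u x = f x) →
      ∀ x : Site d ((n + 1) * s),
        |u x| ≤ C * M * exp (-(δ * ∑ i, ((((siteOf d s (blk n (windowMap d ((n + 1) * s) x))) i - y₀ i).valMinAbs.natAbs : ℕ) : ℝ))) := by
  classical
  have hd : (0 : ℝ) ≤ d := Nat.cast_nonneg d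
  have hm0 : 0 < min 2 a - (-v₀) := by have : 0 ≤ min 2 a := le_min zero_le_two ha.le; linarith
  obtain ⟨κ, hκ0, hκ1, hκm⟩ := exists_rate (d := d) a ha.le hm0
  have hm : 0 < min 2 a - (-v₀) - 2 * d * κ ^ 2 - a * (exp (2 * d * κ) - 1) := by linarith
  set m := min 2 a - (-v₀) - 2 * d * κ ^ 2 - a * (exp (2 * d * κ) - 1) with hm_def
  -- the mean rate `δ₁ = min(κ, γ∕2)` and the comparison rate `δ = min(δ₁, 1, v₀∕(4d+4))`
  set δ₁ : ℝ := min κ (γ / 2) with hδ₁_def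
  have hδ₁0 : 0 < δ₁ := lt_min hκ0 (by linarith)
  have hδ₁κ : δ₁ ≤ κ := min_le_left _ _
  have h2δ₁ : 2 * δ₁ ≤ γ := by have := min_le_right κ (γ / 2); rw [← hδ₁_def] at this; linarith
  have hδ₁γ : δ₁ ≤ γ := by linarith
  set K : ℝ := (2 * (1 - exp (-δ₁))⁻¹) ^ d with hK
  have hK0 : 0 ≤ K := pow_nonneg (mul_nonneg zero_le_two (inv_nonneg.2 (sub_nonneg.2 (exp_le_one_iff.2 (by linarith))))) d
  set δ : ℝ := min δ₁ (min 1 (v₀ / (4 * d + 4))) with hδ_def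
  have hδ0 : 0 < δ := lt_min hδ₁0 (lt_min one_pos (by positivity))
  have hδδ₁ : δ ≤ δ₁ := min_le_left _ _
  have hδ1 : δ ≤ 1 := (min_le_right _ _).trans (min_le_left _ _)
  have hδv : δ ≤ v₀ / (4 * d + 4) := (min_le_right _ _).trans (min_le_right _ _)
  have hgap : 4 * d * δ ^ 2 ≤ v₀ := by
    have h1 : δ ^ 2 ≤ δ := by nlinarith
    have h2 : δ * (4 * d + 4) ≤ v₀ := by rwa [le_div_iff₀ (by positivity)] at hδv
    nlinarith
  have hminv : 0 ≤ m⁻¹ := inv_nonneg.2 hm.le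
  refine ⟨2 * (1 + a * (m⁻¹ * exp (2 * d * κ)) * K) * (4 : ℝ) ^ d * exp (2 * d) / v₀, δ, by positivity, hδ0, ?_⟩
  intro n s _ V hV y₀ M u f hf hu x
  have hVl : ∀ x, -(-v₀) ≤ V x := fun x => by linarith [hV x]
  have hM : 0 ≤ M := le_of_mul_le_mul_right (by rw [zero_mul]; exact (abs_nonneg _).trans (hf x)) (exp_pos _)
  obtain ⟨ψ, hψ⟩ := exists_blockColumns n a s ha.le hm0 V hVl
  have hmean : ∀ y : Site d s, |(((n : ℝ) + 1) ^ d)⁻¹ * ∑ z : Fin d → Fin (n + 1), u (siteOf d ((n + 1) * s) (chart n (windowMap d s y) z))|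
      ≤ (m⁻¹ * exp (2 * d * κ)) * M * K * exp (-(δ₁ * ∑ i, (((y i - y₀ i).valMinAbs.natAbs : ℕ) : ℝ))) :=
    fun y => blockMean_le_of_supProfile n a s ha.le hκ0 hκ1 hm hδ₁0 hδ₁κ h2δ₁ V hVl ψ hψ y₀ u f hf hu y
  -- the source of `L_Vu`
  have hG : ∀ x' : Site d ((n + 1) * s),
      |f x' - a / ((n : ℝ) + 1) ^ d * ∑ q ∈ B n (blk n (windowMap d ((n + 1) * s) x')), u (siteOf d ((n + 1) * s) q)|
        ≤ M * (1 + a * (m⁻¹ * exp (2 * d * κ)) * K)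
          * exp (-(δ₁ * ∑ i, ((((siteOf d s (blk n (windowMap d ((n + 1) * s) x'))) i - y₀ i).valMinAbs.natAbs : ℕ) : ℝ))) := by
    intro x'
    obtain ⟨⟨y, z⟩, hyz⟩ := siteOf_chart_surjective n s x'
    simp only at hyz
    have hblk : siteOf d s (blk n (windowMap d ((n + 1) * s) x')) = y := by
      rw [← hyz]; exact blockOf_siteOf_of_mem n s (mem_B.2 (blk_chart n (windowMap d s y) z))
    have hρ : 0 ≤ ∑ i, (((y i - y₀ i).valMinAbs.natAbs : ℕ) : ℝ) := Finset.sum_nonneg fun _ _ => Nat.cast_nonneg _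
    have hE := exp_pos (-(δ₁ * ∑ i, (((y i - y₀ i).valMinAbs.natAbs : ℕ) : ℝ)))
    rw [hblk]
    have hf' : |f x'| ≤ M * exp (-(δ₁ * ∑ i, (((y i - y₀ i).valMinAbs.natAbs : ℕ) : ℝ))) := by
      have h := hf x'
      rw [hblk] at h
      exact h.trans (mul_le_mul_of_nonneg_left (exp_le_exp.2 (by nlinarith [mul_le_mul_of_nonneg_right hδ₁γ hρ])) hM)
    have hB : |a / ((n : ℝ) + 1) ^ d * ∑ q ∈ B n (blk n (windowMap d ((n + 1) * s) x')), u (siteOf d ((n + 1) * s) q)|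
        ≤ a * ((m⁻¹ * exp (2 * d * κ)) * M * K * exp (-(δ₁ * ∑ i, (((y i - y₀ i).valMinAbs.natAbs : ℕ) : ℝ)))) := by
      rw [← hyz, blockTerm_eq n s u y z, div_eq_mul_inv, mul_assoc, abs_mul, abs_of_pos ha]
      exact mul_le_mul_of_nonneg_left (hmean y) ha.le
    calc |f x' - a / ((n : ℝ) + 1) ^ d * ∑ q ∈ B n (blk n (windowMap d ((n + 1) * s) x')), u (siteOf d ((n + 1) * s) q)|
        ≤ |f x'| + |a / ((n : ℝ) + 1) ^ d * ∑ q ∈ B n (blk n (windowMap d ((n + 1) * s) x')), u (siteOf d ((n + 1) * s) q)| := abs_sub _ _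
      _ ≤ M * exp (-(δ₁ * ∑ i, (((y i - y₀ i).valMinAbs.natAbs : ℕ) : ℝ)))
          + a * ((m⁻¹ * exp (2 * d * κ)) * M * K * exp (-(δ₁ * ∑ i, (((y i - y₀ i).valMinAbs.natAbs : ℕ) : ℝ)))) := add_le_add hf' hB
      _ = _ := by ring
  have h := pointwise_decay n s hv₀ hδ0 hδ1 hδδ₁ hgap V hV y₀ u
    (fun x' => f x' - a / ((n : ℝ) + 1) ^ d * ∑ q ∈ B n (blk n (windowMap d ((n + 1) * s) x')), u (siteOf d ((n + 1) * s) q))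
    hG (fun x' => by linarith [hu x']) x
  refine h.trans (mul_le_mul_of_nonneg_right ?_ (exp_pos _).le)
  have he : exp (2 * d * δ) ≤ exp (2 * d) := exp_le_exp.2 (by nlinarith)
  have h0 : 0 ≤ 2 * (M * (1 + a * (m⁻¹ * exp (2 * d * κ)) * K)) * (4 : ℝ) ^ d := by positivity
  rw [div_le_iff₀ hv₀]
  have e1 : 2 * (1 + a * (m⁻¹ * exp (2 * d * κ)) * K) * (4 : ℝ) ^ d * exp (2 * d) / v₀ * M * v₀
      = 2 * (M * (1 + a * (m⁻¹ * exp (2 * d * κ)) * K)) * (4 : ℝ) ^ d * exp (2 * d) := by field_simp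
  rw [e1]
  nlinarith [mul_le_mul_of_nonneg_left he h0]

/-! ## §3. Toy -/

/-- Toy (`d = 0`, `a = v₀ = γ = 1`): the headline's hypotheses are inhabited, so the constants exist. -/
example : ∃ C δ : ℝ, 0 < C ∧ 0 < δ :=
  let ⟨C, δ, hC, hδ, _⟩ := pointwise_decay_of_supProfile (d := 0) 1 one_pos (v₀ := 1) (γ := 1) one_pos one_pos; ⟨C, δ, hC, hδ⟩

end Summit.QuantumFields.BalabanUV.T4Continuum.NE7b.SupTorusPointwiseProfile
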